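import Summits.QuantumFields.YangMills.Theorems.BalabanUVNodesN08AtRecord13
import Literature.MathematicalPhysics.QuantumFieldTheory.Balaban1983to89.Node00.Record13CarriersCoPR
import Literature.MathematicalPhysics.QuantumFieldTheory.Balaban1983to89.Node00.Record13LiveSelectorFamily

/-!
# BalabanUVNodes ∕ N08 AT THE STAGE-13 RECORD — v1.6 `CoPR` EDITION OF RECORD 13 (director-ym LINE №169 (H1) ∕ №174 PRESS WORD; FINDING №8 = node00-def-T LOCATED-8 «the residual 𝐓-weight slot `Stage12Params.Zt K` is
RUN-BLIND while print's ζ ([Balaban1988Convergent] (1.11) p.248, (3.16)–(3.20) pp.268–269) reads the run»): def-T FILE 25 `Node00/Record13CoPR` (p529474 ✓ 3eadf656eaa8: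
`structure Stage13RParams extends Stage13Params` + the ONE new field `Zr : (p : B12.RunParams) → TkResidualW F N (FluctV N) p.K`, guard `Stage13RParams.ZrUnity`, 𝐓-weights
`WtOfRecord₁₃R θ p` reading `θ.Zr p`, the C-keyed provisos `Stage13RParams.Provisos₁₃CoPR` (the nine Core rows + `zrLaws ∕ zrLocal`), view `Stage13RParams.toStage5₁₃CoPR`, datum
`datumOfRecord₁₃CoPR`, record `IsRecordOfRecord₁₃CCoPR` + faces; run-blind embedding `Stage13RParams.ofRunBlind`) and FILE 26T `Node00/Record13SepCoPR` (p529780 ✓: `Provisos₁₃SepCoPR`,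
`datumOfRecord₁₃SepCoPR`, `IsRecordOfRecord₁₃CSepCoPR` + `.toCoPR`); dag-n10-d's R carrier leaves `Node00/Record13CarriersCoPR` (p530591 ✓: §0 THE R-PIN ALGEBRA `Stage13RParams.onBase ∕ rebindX ∕
pin<G>` (dag-lead DEDUP-286 (2), this seat's DESIGN-INPUT-R), `toStage5₁₃CoPR_rebindX ∕ _pin<G>`, `Provisos₁₃CoPR.rebindX ∕ .pin<G>`, `datumOfRecord₁₃CoPR_rebindX ∕ _pin<G>`,
`isRecordOfRecord₁₃CCoPR_rebindX_of_eq ∕ _pinB10_of_eq`, `exists_world_isRecordOfRecord₁₃CCoPR_rebindX`, the R views `Stage13RParams.view₁₃CoPRB10YZW ∕ …B8B10YZW` + `_eq` + `_leaves`) and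
`Node00/Record13CarriersSepCoPR` (n10-d file (2), after p530591: `Provisos₁₃SepCoPR.pin<G>`, `datumOfRecord₁₃SepCoPR_pin<G>`, `isRecordOfRecord₁₃CSepCoPR_pinB10_of_eq`).  Token map T₆ (plan IMPACT-169, def-T KEYMAP v1.6,
dag-lead WORDS-142): «the v1.5 names with `CoP ↦ CoPR`, binders `Stage13Params ↦ Stage13RParams`, `ZtUnity ↦ ZrUnity`, `Provisos₁₃Core ↦ Provisos₁₃CoPR` (C-keyed family), `θ.Zt p.K ↦ θ.Zr p`».
# THIS FILE = the T₆ image of this seat's v1.5 C-keyed storey `BalabanUVNodesN08AtRecord13CoP` (p523337) (Track A, DAG node N08 [Balaban1985UV3] CMP **102** (1985) 255, Thm 1 p. 257 (compact reading) + Thm 2 p. 272; R134 fan-out seat `pub-ymgap-dag-n08-c` g16, strategy s2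
«knit at the record of record», trigger (t27) = №174 (3) «pens port their OWN files»; 2026-08-27)

WHY THIS FILE.  v1.6 is the first Record-13 edition whose PARAMETER TYPE changes (`θ : Stage13RParams F N`): the record's world clause reads `θ.toStage5₁₃CoPR`, whose 𝐓-weights read
`θ.Zr p`, so no `Stage13Params`-keyed storey (p491313 U_old, p517790 Co, p523337 CoP) instantiates at a CoPR record, and `θ.pinB10 F N` must be dag-n10-d's R-pin (the parent's would drop
`Zr`).  The §1 closers are again ONE `exact` each over this seat's record-stage-generic `BalabanUVNodesN08AtStage5View` (p489533, generic over ANY [B10]-pinned `Stage5Params` view — no twin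
needed at any edition); §0a is NEW at `Stage13RParams`: p491313's guard-per-pin faces `N08AtRecord13.guard_pin<G>_iff` are `Stage13Params`-level, so their R images are declared here
(`Iff.rfl` again — no pin touches `Zr`, `SlotsNondegenerate₁₃` reads the pin-blind base).
HONEST DEPARTURES FROM A PURE TOKEN IMAGE (generator `tools/copr_n08_gen.py` + `tools/genericize_witness_n08.py`; every other statement SHAPE verbatim, proofs re-checked):
(i) the 𝐑-bundle `WOfRecord₁₃` (12a; reads no 𝐓-slot, NOT re-issued by def-T) is fed the base `θ.toStage13Params` (plan's K1 v4 text does the same); (ii) every WITNESS-LINE theorem is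
stated at the R-LIFT `⟨θ₀, Zr⟩ : Stage13RParams F N` of node00-def-K0a's v1.5 maker `θ₀` (`theta13LiveOfRecord ∕ theta13LiveOfNumerics … ∕ theta13LiveOfFamily₂ …`, θ-level and
background-free) by an ARBITRARY run-indexed residual family `Zr`; admissibility and `SlotsNondegenerate₁₃` of the lift ARE K0a's faces of `θ₀` through the base (definitional), while
the guard half `ZrUnity` — whose K0a hypothesis-free face `ztUnity_…` has no R image until K0a pins `Zr` (№174 (5)) — is DISPLAYED as `hZ` in the `N = 2` forms (K0a FILE 17
`ZrOfRecord₁₃ ∕ finsum_ζ0_ZrOfRecord₁₃`, dag-n11-d's diagonal cure as a definition, discharges it at `Zr := ZrOfRecord₁₃ F N θ₀`: `fun p j ω => finsum_ζ0_ZrOfRecord₁₃ …`).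

WHAT IS PROVED (all bookkeeping BY NAME, one `exact`∕`obtain` each):
* §0 the in-edge guards `b4 b5 b6 b7` at every run of every ₁₃CCoPR record (def-T's `atWorld_of_isRecordOfRecord₁₃CCoPR`), hence N08 there reads `b8 → b9 → b11 → b10`;
* §0a the guard `ZrUnity ∧ SlotsNondegenerate₁₃` is blind to the [B10] ∕ Y ∕ Z ∕ W pins and to any `X`-re-binding at `Stage13RParams` (`Iff.rfl` ×4; the `rebindX` ∕ [B13] ∕ X-pin faces are dag-n10-d's `Stage13RParams.guard_rebindX_iff ∕ …`);
* §0b the [B10]-pinned R view's `b10` leaf `= PrintedUV3V N θ.L` (n10-d's `toStage5₁₃CoPR_pinB10`), the four-pin R view IS p489533's four-pin word at `σ := θ.toStage5₁₃CoPR` (`rfl`), and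
  «a world with def-T's pointed clauses bound over the [B10]-pinned ∕ the four-pin R view IS a ₁₃CCoPR record AT `datumOfRecord₁₃CoPR θ h`» + its existence, any window `0 < γw ≤ θ.γ`;
* §1 POINTED CLOSERS at a world bound over `(θ.pinB10).toStage5₁₃CoPR`, over any four-pin word over `θ.toStage5₁₃CoPR`, over `θ.view₁₃CoPRB10YZW` and the [B8]-inner S-bound five-pin
  words: N08 ⟸ `PrintedUV3V N θ.L` (⟺ «in-edges → it»; converse `printedUV3V_of_…`) — proviso-free: the binders FILE 26T's `…SepCoPR` record presents its world in;
* §2 THE ∃-CURRENCY AT THE C KEY: from `θ`, `h : θ.Provisos₁₃CoPR F N`, admissibility and `PrintedUV3V N θ.L` — a world that IS a ₁₃CCoPR record of `datumOfRecord₁₃CoPR θ h`, bound over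
  the pinned ∕ four-pin R view, carrying N08 at every run; the PINNED and FOUR-PIN PRESENTATIONS (same datum, guard and admissibility read AT the presenting parameter);
  «`∃ θ, Provisos₁₃CoPR ∧ (ZrUnity ∧ SlotsNondegenerate₁₃) ∧ Admissible` + the slot at every odd `L > 1` ⟹ N08's conjunct of a C-keyed nodes-∃» (`…_of_inhabited13CoPR`, `_two` at `N = 2`);
* §3 on the R-lifts `⟨θ₁₃, Zr⟩` of K0a's WITNESS LINE OF RECORD `θ₁₃ = theta13LiveOfRecord F N` (`L = F.L`, `γ = 1∕2`): N08's share costs `hP : Provisos₁₃CoPR` there (HYPOTHESIS, opaque)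
  + `PrintedUV3V N F.L` (+ `hZ` for the guard at `N = 2`).

HONEST FRAMING.  Count-neutral kernel bookkeeping BY NAME — a re-keying of a LANDED storey to the re-issued record (new file; p523337 stays as the ⁵ sibling of record).  NOT A
DISCHARGE OF N08: `PrintedUV3V` is TYPED and DISPLAYED as a hypothesis (resp. returned as the pin), NOT PROVED — an inhabitant (the [B10] cluster expansion at print's run objects)
remains THE object gap; `Provisos₁₃(Sep)CoPR`, admissibility and the guard are hypotheses or K0a's theorems, never asserted; K0 ∕ K1 neither proved nor assumed; nothing of
Bałaban's asserted; one finite four-torus per run at fixed `ε`, [B10]'s d = 3 lattices inside the record; nothing continuum ∕ ℝ⁴ ∕ OS ∕ mass gap ∕ Clay.  0 `sorry`, 0 `def`, standard axioms.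
Sources: [Balaban1985UV3] Thm 1 p.257, Thm 2 p.272; [Balaban1989LargeFieldII] Thm 1 + (0.1) pp.355–356; [Balaban1988Convergent] (1.11) p.248, (2.18) p.257, (3.16)–(3.22) pp.268–269;
[Balaban1985Variational] (5)–(7) p.278; [Balaban1985RegularSpaces] (1.7), (1.9) p.77; [Balaban1987RG1] (0.21) p.256.
-/

noncomputable section

namespace Summit.QuantumFields.YangMills.BalabanUVNodes.N08AtRecord13CoPR

open Literature.MathematicalPhysics.QuantumFieldTheory.Balaban1983to89
open Literature.MathematicalPhysics.QuantumFieldTheory.Balaban1983to89.T4Continuum (T4Family FiniteEpsData)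
open Literature.MathematicalPhysics.QuantumFieldTheory.Balaban1983to89.DagBinding
  (WorldP leavesP PrintedCarriersR PrintedCarriers9X PrintedCarriers11 PrintedCarriers15)
open Literature.MathematicalPhysics.QuantumFieldTheory.Balaban1983to89.Node00
open Summit.QuantumFields.YangMills.BalabanUVNodes.N08AtStage5View
open scoped Matrix.Norms.L2Operator

variable {F : T4Family} {N : ℕ} [NeZero N]

/-! ## §0 THE IN-EDGE GUARDS AT EVERY RUN OF EVERY STAGE-13 RECORD AT PRINT'S BACKGROUND (Core key) -/

section Guards
variable {D : FiniteEpsData F (SU N)} {w : WorldP}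

/-- **In-edge guards at every run of a ₁₃CCoPR record**: the leaves `b4`, `b5`, `b6`, `b7` HOLD — N01 ∕ N02 ∕ N03 ∕ N04 are NODE 00 theorems at the Stage-5 shadow
(`Node00.b4∕b5∕b7_main_of_isRecordOfRecord₅C`, `Node00.N03_at_record₅C`), transferred by def-T's FILE 23 `Node00.atWorld_of_isRecordOfRecord₁₃CCoPR` (p491313 §0, re-keyed; holders of a v1.6 record pass `.toCoPR`).
[cite: Balaban1983RegularityDecay, Theorem p.573; Balaban1984PropagatorsI, Props. 1.1–1.2 pp.33–36; Balaban1984PropagatorsII, Lemma 2.1 – Cor. 2.8 pp.234–249; Balaban1985Averaging, Props. 1–10 pp.26–50 (kernel versions at the objects of record; bookkeeping, transferred)] -/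
theorem guards_of_isRecordOfRecord₁₃CCoPR (h : IsRecordOfRecord₁₃CCoPR F N D w) (P : B12.RunParams) :
    (leavesP w P).b4 ∧ (leavesP w P).b5 ∧ (leavesP w P).b6 ∧ (leavesP w P).b7 :=
  atWorld_of_isRecordOfRecord₁₃CCoPR (X := fun ℓ => ℓ.b4 ∧ ℓ.b5 ∧ ℓ.b6 ∧ ℓ.b7)
    (fun _ _ h5 Q =>
      have h4 := b4_main_of_isRecordOfRecord₅C h5 Q
      have hb5 := b5_main_of_isRecordOfRecord₅C h5 Q h4
      ⟨h4, hb5, N03_at_record₅C h5 Q h4 hb5, b7_main_of_isRecordOfRecord₅C h5 Q hb5⟩)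
    h P

/-- Hence at a ₁₃CCoPR record N08 reads `b8 → b9 → b11 → b10` (the in-edges `b5 b6 b7` drop out). [cite: Balaban1985UV3, Thm 1 p.257, Thm 2 p.272 (bookkeeping)] -/
theorem b10_main_iff_residual_of_isRecordOfRecord₁₃CCoPR (h : IsRecordOfRecord₁₃CCoPR F N D w) (P : B12.RunParams) :
    Dag.B10_main (leavesP w P) ↔ ((leavesP w P).b8 → (leavesP w P).b9 → (leavesP w P).b11 → (leavesP w P).b10) := by
  obtain ⟨-, h5, h6, h7⟩ := guards_of_isRecordOfRecord₁₃CCoPR h P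
  exact ⟨fun H h8 h9 h11 => H h5 h6 h7 h8 h9 h11, fun H _ _ _ h8 h9 h11 => H h8 h9 h11⟩

end Guards

/-! ## §0a THE GUARD `ZrUnity ∧ SlotsNondegenerate₁₃` IS PIN-BLIND AT `Stage13RParams` — the R images of p491313 §0b `N08AtRecord13.guard_pin<G>_iff` (`Iff.rfl`: no pin touches
`Zr`; `SlotsNondegenerate₁₃` reads the base `toStage13Params`, itself pin-blind) -/

section GuardFaces
variable (θ : Stage13RParams F N)

/-- The v1.6 guard is [B10]-pin-blind (`Iff.rfl`). [cite: Balaban1988Convergent, (3.16)–(3.22) pp.268–269 (bookkeeping)] -/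
theorem guard_pinB10_iff : ((θ.pinB10 F N).ZrUnity F N ∧ (θ.pinB10 F N).SlotsNondegenerate₁₃ F N) ↔ (θ.ZrUnity F N ∧ θ.SlotsNondegenerate₁₃ F N) := Iff.rfl

/-- … Y-pin-blind (`Iff.rfl`). [cite: Balaban1988Convergent, (3.16)–(3.22) pp.268–269 (bookkeeping)] -/
theorem guard_pinY_iff (Y₀ : PrintedCarriers9X) :
    ((θ.pinY F N Y₀).ZrUnity F N ∧ (θ.pinY F N Y₀).SlotsNondegenerate₁₃ F N) ↔ (θ.ZrUnity F N ∧ θ.SlotsNondegenerate₁₃ F N) := Iff.rfl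

/-- … Z-pin-blind (`Iff.rfl`). [cite: Balaban1988Convergent, (3.16)–(3.22) pp.268–269 (bookkeeping)] -/
theorem guard_pinZ_iff (Z₀ : PrintedCarriers11) :
    ((θ.pinZ F N Z₀).ZrUnity F N ∧ (θ.pinZ F N Z₀).SlotsNondegenerate₁₃ F N) ↔ (θ.ZrUnity F N ∧ θ.SlotsNondegenerate₁₃ F N) := Iff.rfl

/-- … W-pin-blind (`Iff.rfl`). [cite: Balaban1988Convergent, (3.16)–(3.22) pp.268–269 (bookkeeping)] -/
theorem guard_pinW_iff (W₀ : B12.RunParams → PrintedCarriers15) :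
    ((θ.pinW F N W₀).ZrUnity F N ∧ (θ.pinW F N W₀).SlotsNondegenerate₁₃ F N) ↔ (θ.ZrUnity F N ∧ θ.SlotsNondegenerate₁₃ F N) := Iff.rfl

end GuardFaces

/-! ## §0b THE [B10]-PIN ∕ FOUR-PIN CoPR-VIEW FACES THIS FILE READS, over dag-n10-d's `Node00/Record13CarriersCoPR` (`Stage13RParams.toStage5₁₃CoPR_pinB10`, `view₁₃CoPRB10YZW(_eq)`,
`datumOfRecord₁₃CoPR_pin<G>`, `isRecordOfRecord₁₃CCoPR_pinB10_of_eq`, `upOfRecord₅C(S)_view₁₃CoPR…_leaves`), `Record13CarriersSep` §1 (`Provisos₁₃CoPR.pin<G>`) and `Record13Carriers`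
(`Stage13RParams.pin<G>`, `…_admissible_iff`) BY NAME: the pinned CoPR view's `b10` leaf, the ₁₃CCoPR record over the FOUR-PIN CoPR view, and the two world constructions — in THIS
namespace; the guard-per-pin faces are p491313's `N08AtRecord13CoPR.guard_pin<G>_iff` (θ-level, cited) -/

section PinFaces
variable (θ : Stage13RParams F N)

/-- **`(upOfRecord₅C ((θ.pinB10).toStage5₁₃CoPR) P).b10 ↔ PrintedUV3V N θ.L`** — g29's Stage-5 face along `Record13CarriersCoPR`'s `toStage5₁₃CoPR_pinB10` (`rfl`). [cite: Balaban1985UV3, Thm 1 p.257 (compact reading) + Thm 2 p.272] -/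
theorem upOfRecord₅C_toStage5₁₃CoPR_pinB10_b10_iff (P : B12.RunParams) :
    (upOfRecord₅C F N ((θ.pinB10 F N).toStage5₁₃CoPR F N) P).b10 ↔ PrintedUV3V N θ.L := by
  rw [Stage13RParams.toStage5₁₃CoPR_pinB10]
  exact upOfRecord₅C_pinB10_b10_iff F N (θ.toStage5₁₃CoPR F N) P

/-- … read by n05-a's S-binding (which re-binds `b8` only; `Iff.rfl` through it). [cite: Balaban1985UV3, Thm 1 p.257 + Thm 2 p.272; Balaban1985RegularSpaces, Thm 8 p.101 (bookkeeping)] -/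
theorem upOfRecord₅CS_toStage5₁₃CoPR_pinB10_b10_iff (P : B12.RunParams) :
    (upOfRecord₅CS F N ((θ.pinB10 F N).toStage5₁₃CoPR F N) P).b10 ↔ PrintedUV3V N θ.L :=
  upOfRecord₅C_toStage5₁₃CoPR_pinB10_b10_iff θ P

/-- n10-d's `Stage13RParams.view₁₃CoPRB10YZW` IS p489533's four-pin word at `σ := θ.toStage5₁₃CoPR` (`rfl`). [cite: Balaban1989LargeFieldII, Thm 1 p.355 (bookkeeping)] -/
theorem view₁₃CoPRB10YZW_eq_pin4 (Mstar : ℕ) (ops : OpsY N θ.toStage3Params Mstar) (ζ : ResidZ F N) (lamW : ResidW F N) :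
    θ.view₁₃CoPRB10YZW F N Mstar ops ζ lamW =
      ((((θ.toStage5₁₃CoPR F N).pinB10 F N).pinY F N (Y9OfRecord N θ.toStage3Params Mstar ops)).pinZ F N (Z11OfRecord F N ζ)).pinW F N (WOfRecord₁₃ F N θ.toStage13Params lamW) :=
  rfl

/-- **EVERY admissible Stage-13 parameter with the CORE provisos presents a ₁₃CCoPR record at its own CoPR datum whose world is bound over the [B10]-PINNED CoPR view**, any window
`0 < γw ≤ θ.γ`, block size `θ.L` (def-T's world construction at `θ.pinB10`, through `Record13CarriersCoPR`'s `isRecordOfRecord₁₃CCoPR_pinB10_of_eq`). [cite: Balaban1989LargeFieldII, Thm 1 + (0.1) pp.355–356 (bookkeeping)] -/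
theorem exists_world_isRecordOfRecord₁₃CCoPR_pinB10 (h : θ.Provisos₁₃CoPR F N) (hθ : θ.Admissible F N) {γw : ℝ} (hγw : 0 < γw ∧ γw ≤ θ.γ) :
    ∃ w : WorldP, IsRecordOfRecord₁₃CCoPR F N (datumOfRecord₁₃CoPR F N θ h) w ∧ w.γ = γw ∧ w.L = (θ.L : ℝ) ∧
      ∀ P, w.up P = upOfRecord₅C F N ((θ.pinB10 F N).toStage5₁₃CoPR F N) P := by
  obtain ⟨w₀⟩ := nonempty_worldP
  exact ⟨{ w₀ with
      C := (datumOfRecord₁₃CoPR F N θ h).C, γ := γw, L := (θ.L : ℝ), one_lt_L := by exact_mod_cast θ.hL.2,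
      up := fun P => upOfRecord₅C F N ((θ.pinB10 F N).toStage5₁₃CoPR F N) P },
    isRecordOfRecord₁₃CCoPR_pinB10_of_eq F N θ h hθ _ rfl hγw rfl (fun _ => rfl), rfl, rfl, fun _ => rfl⟩

/-- **A world with def-T's pointed clauses bound over n10-d's FOUR-PIN CoPR view IS a ₁₃CCoPR record AT `datumOfRecord₁₃CoPR θ h`** (presenting parameter the quadruply pinned
`θ`; Core provisos transported pin by pin, datum by the four `rfl`s, view by `view₁₃CoPRB10YZW_eq` — p491313 §0b re-keyed).
[cite: Balaban1989LargeFieldII, Thm 1 + (0.1) pp.355–356 (bookkeeping)] -/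
theorem isRecordOfRecord₁₃CCoPR_view₁₃CoPRB10YZW_of_eq (h : θ.Provisos₁₃CoPR F N) (hθ : θ.Admissible F N) (Mstar : ℕ) (ops : OpsY N θ.toStage3Params Mstar)
    (ζ : ResidZ F N) (lamW : ResidW F N) (w : WorldP) (hC : w.C = (datumOfRecord₁₃CoPR F N θ h).C) (hγ : 0 < w.γ ∧ w.γ ≤ θ.γ) (hL : w.L = (θ.L : ℝ))
    (hup : ∀ P, w.up P = upOfRecord₅C F N (θ.view₁₃CoPRB10YZW F N Mstar ops ζ lamW) P) :
    IsRecordOfRecord₁₃CCoPR F N (datumOfRecord₁₃CoPR F N θ h) w := by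
  have h₁ : (θ.pinB10 F N).Provisos₁₃CoPR F N := h.pinB10
  have h₂ : ((θ.pinB10 F N).pinY F N (Y9OfRecord N θ.toStage3Params Mstar ops)).Provisos₁₃CoPR F N := h₁.pinY _
  have h₃ : (((θ.pinB10 F N).pinY F N (Y9OfRecord N θ.toStage3Params Mstar ops)).pinZ F N (Z11OfRecord F N ζ)).Provisos₁₃CoPR F N := h₂.pinZ _
  have h₄ : ((((θ.pinB10 F N).pinY F N (Y9OfRecord N θ.toStage3Params Mstar ops)).pinZ F N (Z11OfRecord F N ζ)).pinW F N (WOfRecord₁₃ F N θ.toStage13Params lamW)).Provisos₁₃CoPR F N :=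
    h₃.pinW _
  have hθ' : ((((θ.pinB10 F N).pinY F N (Y9OfRecord N θ.toStage3Params Mstar ops)).pinZ F N (Z11OfRecord F N ζ)).pinW F N (WOfRecord₁₃ F N θ.toStage13Params lamW)).Admissible F N :=
    (Stage13Params.pinW_admissible_iff F N _ _).2 ((Stage13Params.pinZ_admissible_iff F N _ _).2
      ((Stage13Params.pinY_admissible_iff F N _ _).2 ((Stage13Params.pinB10_admissible_iff F N _).2 hθ)))
  refine ⟨_, h₄, hθ', ?_, hC, hγ, hL, fun P => ?_⟩
  · rw [datumOfRecord₁₃CoPR_pinW F N _ h₃, datumOfRecord₁₃CoPR_pinZ F N _ h₂, datumOfRecord₁₃CoPR_pinY F N _ h₁, datumOfRecord₁₃CoPR_pinB10 F N θ h]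
  · rw [hup P, Stage13RParams.view₁₃CoPRB10YZW_eq]

/-- … hence EVERY admissible Stage-13 parameter with the Core provisos presents a ₁₃CCoPR record at its own CoPR datum whose world is bound over the FOUR-PIN CoPR view (package EXPOSED: any floor
`Mstar`, operator layer `ops`, [B11] layer `ζ`, [IV] layer `lamW`), any window, block size `θ.L`. [cite: Balaban1989LargeFieldII, Thm 1 + (0.1) pp.355–356 (bookkeeping)] -/
theorem exists_world_isRecordOfRecord₁₃CCoPR_view₁₃CoPRB10YZW (h : θ.Provisos₁₃CoPR F N) (hθ : θ.Admissible F N) (Mstar : ℕ) (ops : OpsY N θ.toStage3Params Mstar)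
    (ζ : ResidZ F N) (lamW : ResidW F N) {γw : ℝ} (hγw : 0 < γw ∧ γw ≤ θ.γ) :
    ∃ w : WorldP, IsRecordOfRecord₁₃CCoPR F N (datumOfRecord₁₃CoPR F N θ h) w ∧ w.γ = γw ∧ w.L = (θ.L : ℝ) ∧
      ∀ P, w.up P = upOfRecord₅C F N (θ.view₁₃CoPRB10YZW F N Mstar ops ζ lamW) P := by
  obtain ⟨w₀⟩ := nonempty_worldP
  exact ⟨{ w₀ with
      C := (datumOfRecord₁₃CoPR F N θ h).C, γ := γw, L := (θ.L : ℝ), one_lt_L := by exact_mod_cast θ.hL.2,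
      up := fun P => upOfRecord₅C F N (θ.view₁₃CoPRB10YZW F N Mstar ops ζ lamW) P },
    isRecordOfRecord₁₃CCoPR_view₁₃CoPRB10YZW_of_eq θ h hθ Mstar ops ζ lamW _ rfl hγw rfl (fun _ => rfl), rfl, rfl, fun _ => rfl⟩

end PinFaces

/-! ## §1 POINTED CLOSERS AT A WORLD BOUND OVER THE [B10]-PINNED STAGE-13 CoPR VIEW `toStage5₁₃CoPR` — proviso-free, edition-free; cost: the one slot instance `PrintedUV3V N θ.L` -/

section Pointed
variable (θ : Stage13RParams F N) {w : WorldP}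

/-- **EXACT READING**: at a world whose upstream block is the C-binding over `(θ.pinB10).toStage5₁₃CoPR`, the run's `b10` leaf IS `PrintedUV3V N θ.L` (§0b's
`upOfRecord₅C_toStage5₁₃CoPR_pinB10_b10_iff` read through p489533's generic atom). [cite: Balaban1985UV3, Thm 1 p.257 (compact reading) + Thm 2 p.272] -/
theorem b10_leaf_iff_of_up_pinB10 (hup : ∀ P, w.up P = upOfRecord₅C F N ((θ.pinB10 F N).toStage5₁₃CoPR F N) P) (P : B12.RunParams) :
    (leavesP w P).b10 ↔ PrintedUV3V N θ.L :=
  b10_leaf_iff_of_up_eq (hup P) (upOfRecord₅C_toStage5₁₃CoPR_pinB10_b10_iff θ P)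

/-- **EXACT COST** there: N08 ⟺ «in-edge leaves `b5 b6 b7 b8 b9 b11` ⟹ `PrintedUV3V N θ.L`». [cite: Balaban1985UV3, Thm 1 p.257, Thm 2 p.272 (bookkeeping)] -/
theorem b10_main_iff_of_up_pinB10 (hup : ∀ P, w.up P = upOfRecord₅C F N ((θ.pinB10 F N).toStage5₁₃CoPR F N) P) (P : B12.RunParams) :
    Dag.B10_main (leavesP w P) ↔
      ((leavesP w P).b5 → (leavesP w P).b6 → (leavesP w P).b7 → (leavesP w P).b8 → (leavesP w P).b9 → (leavesP w P).b11 → PrintedUV3V N θ.L) :=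
  b10_main_iff_of_up_eq (hup P) (upOfRecord₅C_toStage5₁₃CoPR_pinB10_b10_iff θ P)

/-- **N08 AT SUCH A WORLD FROM `PrintedUV3V N θ.L`** (in-edges unused; no datum, window or residual-layer hypothesis) — the PINNED binder a pointed Stage-13 assembler
(dag-n24-c's `N24_nodes₁₃_pointed` shape, presented at `θ.pinB10`) takes for N08 in place of the raw leaf-system slot. [cite: Balaban1985UV3, Thm 1 p.257 (compact reading) + Thm 2 p.272; Balaban1989LargeFieldII, Thm 1 + (0.1) pp.355–356 (bookkeeping)] -/
theorem b10_main_of_up_pinB10 (hup : ∀ P, w.up P = upOfRecord₅C F N ((θ.pinB10 F N).toStage5₁₃CoPR F N) P) (hUV : PrintedUV3V N θ.L) (P : B12.RunParams) :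
    Dag.B10_main (leavesP w P) :=
  b10_main_of_up_eq (hup P) (upOfRecord₅C_toStage5₁₃CoPR_pinB10_b10_iff θ P) hUV

/-- Conversely N08 is not idle there: with its in-edge leaves it GIVES `PrintedUV3V N θ.L`. [cite: Balaban1985UV3, Thm 1 p.257, Thm 2 p.272 (bookkeeping)] -/
theorem printedUV3V_of_b10_main_of_up_pinB10 (hup : ∀ P, w.up P = upOfRecord₅C F N ((θ.pinB10 F N).toStage5₁₃CoPR F N) P) {P : B12.RunParams}
    (h : Dag.B10_main (leavesP w P)) (h5 : (leavesP w P).b5) (h6 : (leavesP w P).b6) (h7 : (leavesP w P).b7) (h8 : (leavesP w P).b8)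
    (h9 : (leavesP w P).b9) (h11 : (leavesP w P).b11) : PrintedUV3V N θ.L :=
  of_b10_main_of_up_eq (hup P) (upOfRecord₅C_toStage5₁₃CoPR_pinB10_b10_iff θ P) h h5 h6 h7 h8 h9 h11

/-- The same world spelled over `(θ.toStage5₁₃CoPR).pinB10` (def-T's view, g29's Stage-5 pin; `toStage5₁₃CoPR_pinB10 : rfl`). [cite: Balaban1985UV3, Thm 1 p.257 + Thm 2 p.272 (bookkeeping)] -/
theorem b10_main_of_up_toStage5₁₃CoPR_pinB10 (hup : ∀ P, w.up P = upOfRecord₅C F N ((θ.toStage5₁₃CoPR F N).pinB10 F N) P) (hUV : PrintedUV3V N θ.L)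
    (P : B12.RunParams) : Dag.B10_main (leavesP w P) :=
  N08AtStage5View.b10_main_of_up_pinB10 (θ.toStage5₁₃CoPR F N) (hup P) hUV

/-- S-binding twin (a world bound by n05-a's S-binding over the pinned Stage-13 view). [cite: Balaban1985UV3, Thm 1 p.257 + Thm 2 p.272; Balaban1985RegularSpaces, Thm 8 p.101 (bookkeeping)] -/
theorem b10_main_of_upS_pinB10 (hup : ∀ P, w.up P = upOfRecord₅CS F N ((θ.pinB10 F N).toStage5₁₃CoPR F N) P) (hUV : PrintedUV3V N θ.L) (P : B12.RunParams) :
    Dag.B10_main (leavesP w P) :=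
  b10_main_of_up_eq (hup P) (upOfRecord₅CS_toStage5₁₃CoPR_pinB10_b10_iff θ P) hUV

/-- **N08 AT A WORLD BOUND OVER ANY FOUR-PIN WORD OVER THE STAGE-13 VIEW** — `(((θ.toStage5₁₃CoPR.pinB10).pinY Y₀).pinZ Z₀).pinW W₀` for EVERY `Y₀ Z₀ W₀` (what a cumulative
Stage-13 view `view₁₃CoPRB10YZW` unfolds to) — from `PrintedUV3V N θ.L` (p489533 §3 at `σ := θ.toStage5₁₃CoPR`). [cite: Balaban1985UV3, Thm 1 p.257 (compact reading) + Thm 2 p.272; Balaban1989LargeFieldII, Thm 1 + (0.1) pp.355–356 (bookkeeping)] -/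
theorem b10_main_of_up_pin4 (Y₀ : PrintedCarriers9X) (Z₀ : PrintedCarriers11) (W₀ : B12.RunParams → PrintedCarriers15)
    (hup : ∀ P, w.up P = upOfRecord₅C F N (((((θ.toStage5₁₃CoPR F N).pinB10 F N).pinY F N Y₀).pinZ F N Z₀).pinW F N W₀) P) (hUV : PrintedUV3V N θ.L)
    (P : B12.RunParams) : Dag.B10_main (leavesP w P) :=
  N08AtStage5View.b10_main_of_up_pin4 (θ.toStage5₁₃CoPR F N) Y₀ Z₀ W₀ hup hUV P

/-- … exact cost there. [cite: Balaban1985UV3, Thm 1 p.257, Thm 2 p.272 (bookkeeping)] -/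
theorem b10_main_iff_of_up_pin4 (Y₀ : PrintedCarriers9X) (Z₀ : PrintedCarriers11) (W₀ : B12.RunParams → PrintedCarriers15)
    (hup : ∀ P, w.up P = upOfRecord₅C F N (((((θ.toStage5₁₃CoPR F N).pinB10 F N).pinY F N Y₀).pinZ F N Z₀).pinW F N W₀) P) (P : B12.RunParams) :
    Dag.B10_main (leavesP w P) ↔
      ((leavesP w P).b5 → (leavesP w P).b6 → (leavesP w P).b7 → (leavesP w P).b8 → (leavesP w P).b9 → (leavesP w P).b11 → PrintedUV3V N θ.L) :=
  N08AtStage5View.b10_main_iff_of_up_pin4 (θ.toStage5₁₃CoPR F N) Y₀ Z₀ W₀ hup P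

/-- … and over the [B8]-inner five-pin word bound by the S-binding (the world shape of a `…CB10YZWB8` key at Stage 13). [cite: Balaban1985UV3, Thm 1 p.257 + Thm 2 p.272; Balaban1985RegularSpaces, Thm 8 p.101 (bookkeeping)] -/
theorem b10_main_of_upS_pinB8_pin4 (lam : ResidB8 θ.toStage3Params) (Y₀ : PrintedCarriers9X) (Z₀ : PrintedCarriers11)
    (W₀ : B12.RunParams → PrintedCarriers15)
    (hup : ∀ P, w.up P = upOfRecord₅CS F N ((((((θ.toStage5₁₃CoPR F N).pinB8 F N lam).pinB10 F N).pinY F N Y₀).pinZ F N Z₀).pinW F N W₀) P)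
    (hUV : PrintedUV3V N θ.L) (P : B12.RunParams) : Dag.B10_main (leavesP w P) :=
  N08AtStage5View.b10_main_of_upS_pinB8_pin4 (θ.toStage5₁₃CoPR F N) lam Y₀ Z₀ W₀ hup hUV P


/-- **N08 AT A WORLD BOUND OVER n10-d's FOUR-PIN STAGE-13 VIEW `θ.view₁₃CoPRB10YZW Mstar ops ζ lamW`**, from `PrintedUV3V N θ.L` — ONE `exact` over p489533 (the view IS the
four-pin word, `view₁₃CoPRB10YZW_eq_pin4`). [cite: Balaban1985UV3, Thm 1 p.257 (compact reading) + Thm 2 p.272; Balaban1989LargeFieldII, Thm 1 + (0.1) pp.355–356 (bookkeeping)] -/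
theorem b10_main_of_up_view₁₃CoPRB10YZW (Mstar : ℕ) (ops : OpsY N θ.toStage3Params Mstar) (ζ : ResidZ F N) (lamW : ResidW F N)
    (hup : ∀ P, w.up P = upOfRecord₅C F N (θ.view₁₃CoPRB10YZW F N Mstar ops ζ lamW) P) (hUV : PrintedUV3V N θ.L) (P : B12.RunParams) :
    Dag.B10_main (leavesP w P) :=
  N08AtStage5View.b10_main_of_up_pin4 (θ.toStage5₁₃CoPR F N) _ _ _ hup hUV P

/-- … exact reading there (= the `b10` conjunct of n10-d's `upOfRecord₅C_view₁₃CoPRB10YZW_leaves`, read at the world). [cite: Balaban1985UV3, Thm 1 p.257 + Thm 2 p.272 (bookkeeping)] -/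
theorem b10_leaf_iff_of_up_view₁₃CoPRB10YZW (Mstar : ℕ) (ops : OpsY N θ.toStage3Params Mstar) (ζ : ResidZ F N) (lamW : ResidW F N)
    (hup : ∀ P, w.up P = upOfRecord₅C F N (θ.view₁₃CoPRB10YZW F N Mstar ops ζ lamW) P) (P : B12.RunParams) : (leavesP w P).b10 ↔ PrintedUV3V N θ.L :=
  b10_leaf_iff_of_up_eq (hup P) (upOfRecord₅C_view₁₃CoPRB10YZW_leaves F N θ Mstar ops ζ lamW P).2.2.1

/-- … and over the five-pin view with [B8] bound by the S-binding (`view₁₃CoPRB8B10YZW = (θ.pinB8 λ).view₁₃CoPRB10YZW`). [cite: Balaban1985UV3, Thm 1 p.257 + Thm 2 p.272; Balaban1985RegularSpaces, Thm 8 p.101 (bookkeeping)] -/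
theorem b10_main_of_upS_view₁₃CoPRB8B10YZW (lam : ResidB8 θ.toStage3Params) (Mstar : ℕ) (ops : OpsY N θ.toStage3Params Mstar) (ζ : ResidZ F N)
    (lamW : ResidW F N) (hup : ∀ P, w.up P = upOfRecord₅CS F N (θ.view₁₃CoPRB8B10YZW F N lam Mstar ops ζ lamW) P) (hUV : PrintedUV3V N θ.L)
    (P : B12.RunParams) : Dag.B10_main (leavesP w P) :=
  b10_main_of_up_eq (hup P) (upOfRecord₅CS_view₁₃CoPRB8B10YZW_leaves F N θ lam Mstar ops ζ lamW P).2.2.2.1 hUV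

end Pointed

/-! ## §2 THE ∃-CURRENCY AT THE CORE KEY — N08's conjunct of a Core-keyed nodes-∃, the guard `ZrUnity ∧ SlotsNondegenerate₁₃` riding on `θ` -/

section Currency

/-- **AT THE CO DATUM OF ANY ADMISSIBLE STAGE-13 TUPLE WITH THE CORE PROVISOS, a world (any window height `γw`, block size `θ.L`) that IS a ₁₃CCoPR record of
`datumOfRecord₁₃CoPR F N θ h`, bound over the [B10]-PINNED CoPR view, carrying N08 at every run — from the one slot instance `PrintedUV3V N θ.L`** (§0b
`exists_world_isRecordOfRecord₁₃CCoPR_pinB10` + §1).  The other nodes' pointed closers apply AT THIS `w` (its presenting parameter is `θ.pinB10`: every residual layer but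
the B10 run family, every history, law and letter is `θ`'s — `Record13Carriers` §2). [cite: Balaban1985UV3, Thm 1 p.257, Thm 2 p.272; Balaban1989LargeFieldII, Thm 1 + (0.1) pp.355–356 (the record's world; bookkeeping)] -/
theorem exists_world₁₃CCoPR_b10_main_of_slot (θ : Stage13RParams F N) (h : θ.Provisos₁₃CoPR F N) (hθ : θ.Admissible F N) {γw : ℝ} (hγw : 0 < γw ∧ γw ≤ θ.γ)
    (hUV : PrintedUV3V N θ.L) :
    ∃ w : WorldP, IsRecordOfRecord₁₃CCoPR F N (datumOfRecord₁₃CoPR F N θ h) w ∧ w.γ = γw ∧ w.L = (θ.L : ℝ) ∧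
      (∀ P, w.up P = upOfRecord₅C F N ((θ.pinB10 F N).toStage5₁₃CoPR F N) P) ∧ ∀ P : B12.RunParams, Dag.B10_main (leavesP w P) := by
  obtain ⟨w, hR, hγ, hL, hup⟩ := exists_world_isRecordOfRecord₁₃CCoPR_pinB10 θ h hθ hγw
  exact ⟨w, hR, hγ, hL, hup, b10_main_of_up_pinB10 θ hup hUV⟩

/-- **The four-pin twin** (package EXPOSED, as at Stage 12): at the same datum a world bound over `θ.view₁₃CoPRB10YZW Mstar ops ζ lamW` that IS a ₁₃CCoPR record and carries N08
at every run, from `PrintedUV3V N θ.L` — the world at which the other nodes' pointed closers over the four-pin view apply. [cite: Balaban1985UV3, Thm 1 p.257, Thm 2 p.272; Balaban1989LargeFieldII, Thm 1 + (0.1) pp.355–356 (bookkeeping)] -/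
theorem exists_world₁₃CCoPR_view₁₃CoPRB10YZW_b10_main_of_slot (θ : Stage13RParams F N) (h : θ.Provisos₁₃CoPR F N) (hθ : θ.Admissible F N) (Mstar : ℕ)
    (ops : OpsY N θ.toStage3Params Mstar) (ζ : ResidZ F N) (lamW : ResidW F N) {γw : ℝ} (hγw : 0 < γw ∧ γw ≤ θ.γ) (hUV : PrintedUV3V N θ.L) :
    ∃ w : WorldP, IsRecordOfRecord₁₃CCoPR F N (datumOfRecord₁₃CoPR F N θ h) w ∧ w.γ = γw ∧ w.L = (θ.L : ℝ) ∧
      (∀ P, w.up P = upOfRecord₅C F N (θ.view₁₃CoPRB10YZW F N Mstar ops ζ lamW) P) ∧ ∀ P : B12.RunParams, Dag.B10_main (leavesP w P) := by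
  obtain ⟨w, hR, hγ, hL, hup⟩ := exists_world_isRecordOfRecord₁₃CCoPR_view₁₃CoPRB10YZW θ h hθ Mstar ops ζ lamW hγw
  exact ⟨w, hR, hγ, hL, hup, b10_main_of_up_view₁₃CoPRB10YZW θ Mstar ops ζ lamW hup hUV⟩

/-- **THE PINNED PRESENTATION**: from `θ`, its provisos, admissibility and guard, and `PrintedUV3V N θ.L` — a presenting parameter `θ' := θ.pinB10` with provisos `h'`, THE SAME
datum (`datumOfRecord₁₃CoPR_pinB10`), the guard and admissibility read AT `θ'` (carrier-blind, `Record13Carriers` §2), and a world bound over `θ'.toStage5₁₃CoPR` (def-T's UNPINNED clause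
shape at `θ'` — the `hup` a pointed Stage-13 assembler takes) that IS a ₁₃CCoPR record and carries N08 at every run. [cite: Balaban1985UV3, Thm 1 p.257, Thm 2 p.272; Balaban1989LargeFieldII, Thm 1 + (0.1) pp.355–356; Balaban1988Convergent, (3.16)–(3.22) pp.268–269 (the guard; bookkeeping)] -/
theorem exists_pinned_presentation₁₃CCoPR_b10_main (θ : Stage13RParams F N) (h : θ.Provisos₁₃CoPR F N) (hθ : θ.Admissible F N)
    (hG : θ.ZrUnity F N ∧ θ.SlotsNondegenerate₁₃ F N) {γw : ℝ} (hγw : 0 < γw ∧ γw ≤ θ.γ) (hUV : PrintedUV3V N θ.L) :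
    ∃ (θ' : Stage13RParams F N) (h' : θ'.Provisos₁₃CoPR F N) (w : WorldP), (θ'.ZrUnity F N ∧ θ'.SlotsNondegenerate₁₃ F N) ∧ θ'.Admissible F N ∧
      datumOfRecord₁₃CoPR F N θ' h' = datumOfRecord₁₃CoPR F N θ h ∧ w.C = (datumOfRecord₁₃CoPR F N θ' h').C ∧ (0 < w.γ ∧ w.γ ≤ θ'.γ) ∧ w.γ = γw ∧ w.L = (θ'.L : ℝ) ∧
      (∀ P, w.up P = upOfRecord₅C F N (θ'.toStage5₁₃CoPR F N) P) ∧ IsRecordOfRecord₁₃CCoPR F N (datumOfRecord₁₃CoPR F N θ h) w ∧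
      ∀ P : B12.RunParams, Dag.B10_main (leavesP w P) := by
  obtain ⟨w, hR, hγ, hL, hup, hN⟩ := exists_world₁₃CCoPR_b10_main_of_slot θ h hθ hγw hUV
  refine ⟨θ.pinB10 F N, h.pinB10, w, (N08AtRecord13CoPR.guard_pinB10_iff θ).2 hG, (Stage13Params.pinB10_admissible_iff F N θ.toStage13Params).2 hθ,
    datumOfRecord₁₃CoPR_pinB10 F N θ h, ?_, ?_, hγ, hL, fun P => (hup P).trans (by rw [Stage13RParams.toStage5₁₃CoPR_pinB10]), hR, hN⟩
  · rw [datumOfRecord₁₃CoPR_pinB10 F N θ h]; exact construction_eq_of_isRecordOfRecord₁₃CCoPR hR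
  · rw [hγ]; exact hγw

/-- **THE FOUR-PIN PRESENTATION** (package EXPOSED): presenting parameter `θ' := (((θ.pinB10).pinY (Y9OfRecord …)).pinZ (Z11OfRecord ζ)).pinW (WOfRecord₁₃ θ lamW)` — THE SAME datum
(the four `datumOfRecord₁₃CoPR_pin<G>`), guard and admissibility read AT `θ'` (pin-blind, §0b), a world bound over `θ'.toStage5₁₃CoPR` (= `θ.view₁₃CoPRB10YZW …`, `view₁₃CoPRB10YZW_eq`) that IS a
₁₃CCoPR record of `datumOfRecord₁₃CoPR θ h` and carries N08 at every run — from `PrintedUV3V N θ.L`.  The shape a pointed Stage-13 assembler consumes when it presents the record at the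
quadruply pinned parameter. [cite: Balaban1985UV3, Thm 1 p.257, Thm 2 p.272; Balaban1989LargeFieldII, Thm 1 + (0.1) pp.355–356; Balaban1988Convergent, (3.16)–(3.22) pp.268–269 (bookkeeping)] -/
theorem exists_pinned4_presentation₁₃CCoPR_b10_main (θ : Stage13RParams F N) (h : θ.Provisos₁₃CoPR F N) (hθ : θ.Admissible F N)
    (hG : θ.ZrUnity F N ∧ θ.SlotsNondegenerate₁₃ F N) (Mstar : ℕ) (ops : OpsY N θ.toStage3Params Mstar) (ζ : ResidZ F N) (lamW : ResidW F N) {γw : ℝ}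
    (hγw : 0 < γw ∧ γw ≤ θ.γ) (hUV : PrintedUV3V N θ.L) :
    ∃ (θ' : Stage13RParams F N) (h' : θ'.Provisos₁₃CoPR F N) (w : WorldP), (θ'.ZrUnity F N ∧ θ'.SlotsNondegenerate₁₃ F N) ∧ θ'.Admissible F N ∧
      datumOfRecord₁₃CoPR F N θ' h' = datumOfRecord₁₃CoPR F N θ h ∧ w.C = (datumOfRecord₁₃CoPR F N θ' h').C ∧ (0 < w.γ ∧ w.γ ≤ θ'.γ) ∧ w.γ = γw ∧ w.L = (θ'.L : ℝ) ∧
      (∀ P, w.up P = upOfRecord₅C F N (θ'.toStage5₁₃CoPR F N) P) ∧ (∀ P, w.up P = upOfRecord₅C F N (θ.view₁₃CoPRB10YZW F N Mstar ops ζ lamW) P) ∧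
      IsRecordOfRecord₁₃CCoPR F N (datumOfRecord₁₃CoPR F N θ h) w ∧ ∀ P : B12.RunParams, Dag.B10_main (leavesP w P) := by
  obtain ⟨w, hR, hγ, hL, hup, hN⟩ := exists_world₁₃CCoPR_view₁₃CoPRB10YZW_b10_main_of_slot θ h hθ Mstar ops ζ lamW hγw hUV
  have h₁ : (θ.pinB10 F N).Provisos₁₃CoPR F N := h.pinB10
  have h₂ : ((θ.pinB10 F N).pinY F N (Y9OfRecord N θ.toStage3Params Mstar ops)).Provisos₁₃CoPR F N := h₁.pinY _
  have h₃ : (((θ.pinB10 F N).pinY F N (Y9OfRecord N θ.toStage3Params Mstar ops)).pinZ F N (Z11OfRecord F N ζ)).Provisos₁₃CoPR F N := h₂.pinZ _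
  have h₄ : ((((θ.pinB10 F N).pinY F N (Y9OfRecord N θ.toStage3Params Mstar ops)).pinZ F N (Z11OfRecord F N ζ)).pinW F N (WOfRecord₁₃ F N θ.toStage13Params lamW)).Provisos₁₃CoPR F N :=
    h₃.pinW _
  have hD : datumOfRecord₁₃CoPR F N _ h₄ = datumOfRecord₁₃CoPR F N θ h := by
    rw [datumOfRecord₁₃CoPR_pinW F N _ h₃, datumOfRecord₁₃CoPR_pinZ F N _ h₂, datumOfRecord₁₃CoPR_pinY F N _ h₁, datumOfRecord₁₃CoPR_pinB10 F N θ h]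
  refine ⟨_, h₄, w,
    (N08AtRecord13CoPR.guard_pinW_iff _ _).2 ((N08AtRecord13CoPR.guard_pinZ_iff _ _).2 ((N08AtRecord13CoPR.guard_pinY_iff _ _).2 ((N08AtRecord13CoPR.guard_pinB10_iff θ).2 hG))),
    (Stage13Params.pinW_admissible_iff F N _ _).2 ((Stage13Params.pinZ_admissible_iff F N _ _).2
      ((Stage13Params.pinY_admissible_iff F N _ _).2 ((Stage13Params.pinB10_admissible_iff F N _).2 hθ))),
    hD, ?_, ?_, hγ, hL, fun P => (hup P).trans (by rw [Stage13RParams.view₁₃CoPRB10YZW_eq]), hup, hR, hN⟩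
  · rw [hD]; exact construction_eq_of_isRecordOfRecord₁₃CCoPR hR
  · rw [hγ]; exact hγw

/-- **«A CORE-KEYED INHABITATION ⟹ N08's CONJUNCT OF A CORE-KEYED STAGE-13 NODES-∃»**, generic `N`: from `∃ θ, Provisos₁₃CoPR ∧ (ZrUnity ∧ SlotsNondegenerate₁₃) ∧ Admissible` at `F`
(HYPOTHESIS `hI`, the guard bundled as ONE conjunct and carried to the SAME `θ` untouched) and the slot of record at every odd `L > 1` (HYPOTHESIS `hUV`, the node's object gap),
SOME guarded admissible tuple `θ`, provisos `h` and world `w` with `IsRecordOfRecord₁₃CCoPR F N (datumOfRecord₁₃CoPR F N θ h) w` and `Dag.B10_main` at every run (`γw := θ.γ`).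
NOT the stub (twelve conjuncts missing), NOT a discharge. [cite: Balaban1985UV3, Thm 1 p.257, Thm 2 p.272; Balaban1989LargeFieldII, Thm 1 + (0.1) pp.355–356; Balaban1988Convergent, (3.16)–(3.22) pp.268–269 (bookkeeping)] -/
theorem exists_guarded_record₁₃CCoPR_b10_main_of_inhabited13CoPR
    (hI : ∃ θ : Stage13RParams F N, θ.Provisos₁₃CoPR F N ∧ (θ.ZrUnity F N ∧ θ.SlotsNondegenerate₁₃ F N) ∧ θ.Admissible F N)
    (hUV : ∀ L : ℕ, Odd L → 1 < L → PrintedUV3V N L) :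
    ∃ (θ : Stage13RParams F N) (h : θ.Provisos₁₃CoPR F N) (w : WorldP), (θ.ZrUnity F N ∧ θ.SlotsNondegenerate₁₃ F N) ∧ θ.Admissible F N ∧
      IsRecordOfRecord₁₃CCoPR F N (datumOfRecord₁₃CoPR F N θ h) w ∧ ∀ P : B12.RunParams, Dag.B10_main (leavesP w P) := by
  obtain ⟨θ, h, hG, hθ⟩ := hI
  obtain ⟨w, hR, -, -, -, hN⟩ := exists_world₁₃CCoPR_b10_main_of_slot θ h hθ ⟨hθ.toStage9.gamma_pos, le_rfl⟩ (hUV θ.L θ.hL.1 θ.hL.2)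
  exact ⟨θ, h, w, hG, hθ, hR, hN⟩

/-- **THE SAME AT THE GROUP OF RECORD `N = 2`**, hypothesis = the Core-keyed inhabitation text (the rev-16 K0‴ body at `F` under `Provisos₁₃ ↦ Provisos₁₃CoPR`:
`∃ θ : Stage13RParams F 2, θ.Provisos₁₃CoPR F 2 ∧ (θ.ZrUnity F 2 ∧ θ.SlotsNondegenerate₁₃ F 2) ∧ θ.Admissible F 2`): N08's conjunct of the ₁₃ nodes-∃ from it and the slot at every
odd `L > 1`.  NOT the stub, NOT a discharge. [cite: Balaban1985UV3, Thm 1 p.257, Thm 2 p.272; Balaban1989LargeFieldII, Thm 1 + (0.1) pp.355–356 (bookkeeping)] -/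
theorem exists_guarded_record₁₃CCoPR_b10_main_of_inhabited13CoPR_two (F : T4Family)
    (hI : ∃ θ : Stage13RParams F 2, θ.Provisos₁₃CoPR F 2 ∧ (θ.ZrUnity F 2 ∧ θ.SlotsNondegenerate₁₃ F 2) ∧ θ.Admissible F 2)
    (hUV : ∀ L : ℕ, Odd L → 1 < L → PrintedUV3V 2 L) :
    ∃ (θ : Stage13RParams F 2) (h : θ.Provisos₁₃CoPR F 2) (w : WorldP), (θ.ZrUnity F 2 ∧ θ.SlotsNondegenerate₁₃ F 2) ∧ θ.Admissible F 2 ∧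
      IsRecordOfRecord₁₃CCoPR F 2 (datumOfRecord₁₃CoPR F 2 θ h) w ∧ ∀ P : B12.RunParams, Dag.B10_main (leavesP w P) :=
  exists_guarded_record₁₃CCoPR_b10_main_of_inhabited13CoPR hI hUV

end Currency

/-! ## §3 ON THE STAGE-13 WITNESS LINE OF RECORD `θ₁₃ = theta13LiveOfRecord F N` (θ-level maker, background-free; block size `F.L`, window `γ = 1∕2`; `_L ∕ _γ` are p491313's
`rfl` faces, cited) — N08's share costs `PrintedUV3V N F.L` -/

section WitnessLine
variable (F N) (Zr : (p : B12.RunParams) → TkResidualW F N (FluctV N) p.K)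

/-- **N08's SHARE OF THE STAGE-13 NODES STUB ON THE WITNESS LINE OF RECORD COSTS THE SINGLE PROP `PrintedUV3V N F.L`** (plus the Core provisos `hP` at `θ₁₃`, HYPOTHESIS;
admissibility is K0a's THEOREM `admissible_theta13LiveOfRecord`): a world of `datumOfRecord₁₃CoPR F N θ₁₃ hP` (`w.γ = 1∕2`, `w.L = F.L`), bound over the [B10]-pinned view of `θ₁₃`,
that is a ₁₃CCoPR record and carries N08 at every run.  At `N = 2`: [Balaban1985UV3] Thm 1-compact ∧ Thm 2 with their printed ∃-prefix for SU(2) at the family's block size `F.L`,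
at some version of print's transformations. [cite: Balaban1985UV3, Thm 1 p.257, Thm 2 p.272; Balaban1989LargeFieldII, Thm 1 + (0.1) pp.355–356; Balaban1987RG1, (0.21) p.256 (bookkeeping)] -/
theorem exists_world₁₃CCoPR_b10_main_at_theta13LiveOfRecord (hP : (⟨theta13LiveOfRecord F N, Zr⟩ : Stage13RParams F N).Provisos₁₃CoPR F N) (hUV : PrintedUV3V N F.L) :
    ∃ w : WorldP, IsRecordOfRecord₁₃CCoPR F N (datumOfRecord₁₃CoPR F N (⟨theta13LiveOfRecord F N, Zr⟩ : Stage13RParams F N) hP) w ∧ w.γ = 1 / 2 ∧ w.L = (F.L : ℝ) ∧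
      (∀ P, w.up P = upOfRecord₅C F N (((⟨theta13LiveOfRecord F N, Zr⟩ : Stage13RParams F N).pinB10 F N).toStage5₁₃CoPR F N) P) ∧
      ∀ P : B12.RunParams, Dag.B10_main (leavesP w P) :=
  exists_world₁₃CCoPR_b10_main_of_slot (⟨theta13LiveOfRecord F N, Zr⟩ : Stage13RParams F N) hP (admissible_theta13LiveOfRecord F N) (γw := 1 / 2)
    ⟨one_half_pos, (N08AtRecord13.theta13LiveOfRecord_γ F N).symm.le⟩ hUV

/-- **EXACT COST ON THE LINE**: at any world bound over the [B10]-pinned view of `θ₁₃`, N08 at a run ⟺ «in-edge leaves ⟹ `PrintedUV3V N F.L`». [cite: Balaban1985UV3, Thm 1 p.257, Thm 2 p.272] -/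
theorem b10_main_iff_at_theta13LiveOfRecord {w : WorldP}
    (hup : ∀ P, w.up P = upOfRecord₅C F N (((⟨theta13LiveOfRecord F N, Zr⟩ : Stage13RParams F N).pinB10 F N).toStage5₁₃CoPR F N) P) (P : B12.RunParams) :
    Dag.B10_main (leavesP w P) ↔
      ((leavesP w P).b5 → (leavesP w P).b6 → (leavesP w P).b7 → (leavesP w P).b8 → (leavesP w P).b9 → (leavesP w P).b11 → PrintedUV3V N F.L) :=
  b10_main_iff_of_up_pinB10 (⟨theta13LiveOfRecord F N, Zr⟩ : Stage13RParams F N) hup P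

/-- **N08's CONJUNCT OF THE STAGE-13 NODES-∃, WITNESSED AT `θ₁₃` OF RECORD, `N = 2`** — from the Core provisos at the witness (`hP : θ₁₃.Provisos₁₃CoPR F 2`, HYPOTHESIS) and
`PrintedUV3V 2 F.L`: the guard (the DISPLAYED `hZ : ZrUnity` of the lift ∕ K0a's HYPOTHESIS-FREE `slotsNondegenerate₁₃_theta13LiveOfRecord_of_hasResiduals`) and admissibility are K0a's theorems BY NAME.  NOT the stub, NOT
a discharge. [cite: Balaban1985UV3, Thm 1 p.257, Thm 2 p.272; Balaban1988Convergent, Thm 1 p.262, (3.16)–(3.22) pp.268–269; Balaban1989LargeFieldI, (0.3)–(0.4) p.176 (bookkeeping)] -/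
theorem exists_guarded_record₁₃CCoPR_b10_main_of_theta13Live_provisosCoPR_two (F : T4Family) (Zr : (p : B12.RunParams) → TkResidualW F 2 (FluctV 2) p.K) (hP : (⟨theta13LiveOfRecord F 2, Zr⟩ : Stage13RParams F 2).Provisos₁₃CoPR F 2)
    (hZ : (⟨theta13LiveOfRecord F 2, Zr⟩ : Stage13RParams F 2).ZrUnity F 2) (hUV : PrintedUV3V 2 F.L) :
    ∃ (θ : Stage13RParams F 2) (h : θ.Provisos₁₃CoPR F 2) (w : WorldP), (θ.ZrUnity F 2 ∧ θ.SlotsNondegenerate₁₃ F 2) ∧ θ.Admissible F 2 ∧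
      IsRecordOfRecord₁₃CCoPR F 2 (datumOfRecord₁₃CoPR F 2 θ h) w ∧ ∀ P : B12.RunParams, Dag.B10_main (leavesP w P) := by
  obtain ⟨w, hR, -, -, -, hN⟩ := exists_world₁₃CCoPR_b10_main_at_theta13LiveOfRecord F 2 Zr hP hUV
  exact ⟨_, hP, w, ⟨hZ, slotsNondegenerate₁₃_theta13LiveOfRecord_of_hasResiduals F 2⟩, admissible_theta13LiveOfRecord F 2, hR, hN⟩

end WitnessLine

end Summit.QuantumFields.YangMills.BalabanUVNodes.N08AtRecord13CoPR

end
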